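/-
Copyright: cell pub-balaban-gaps (YM BLITZ Y1, track G1), seat g1-p2 GEN 9 (unit `pub-balaban-gaps-g1-p2`).  Row (D4) NODE O,
OBJECT ∕ MECHANISM level: CONJUGATION of a block walk expansion by CUBE-LOCAL, row-bounded operators — the block-currency form of
the GAUGE TRANSFER ([B9] p. 398: *"All these inequalities are invariant with respect to gauge transformations of U"*; Cor. 3.6 p. 408:
the results at `U′ = U^u = e^{iηA}` transfer to `U`): a site gauge transformation acts on sections by a SITE-DIAGONAL fibre matrix, hence by
a cube-local operator, and `G(U^g) = 𝒢G(U)𝒢⁻¹`; in block norms a cube-local factor costs only its row-sum bound (no cube sum, no fibre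
count).  Also the form of any fibre-basis change (the fibre-norm dictionary).  HONEST FRAMING: elementary; nothing of Bałaban's asserted;
(D4) instance 0∕1; NOT BetaPertH, NOT continuum, NOT Clay.
-/
import Summits.QuantumFields.BalabanUV.Gaps.D4WalkBlock

/-!
# `Gaps.D4WalkBlockConjugate` — cube-local operators in block currency and the conjugation `𝒢·K·𝒢′` of a block walk expansion
# (cell pub-balaban-gaps, seat g1-p2 gen 9)

HONEST DEPENDENCY (cell pub-balaban, verbatim): continuum YM on T⁴ ⇐ BetaPertH ∧ nine spine estimates (0/9 proved);
BetaPertH ⇐ (D1) ∧ (D4) ∧ CAP+tail.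

* §1 cube-local operators (`𝒢 i j = 0` unless `cub i = cub j`) with row sums `≤ r`: `blockNorm_local_offDiag` (off-diagonal blocks vanish),
  `blockNorm_local_le` (every block `≤ r`), **`blockNorm_local_mul_le`** (`‖𝒢M‖_{y,y′} ≤ r‖M‖_{y,y′}`), **`blockNorm_mul_local_le`**
  (`‖M𝒢′‖_{y,y′} ≤ ‖M‖_{y,y′}r′`) — via `D4WalkBlock.blockNorm_mul_le`, the cube sum collapsing to the diagonal term.
* §2 **`BlockWalkExpansion.conj`** (declared in `D4WalkBlock`'s namespace for dot notation, like 55's `leftMul` ∕ `congrK`): a block walk expansion of `K(σ,u)` with terms `T_ω`, amplitudes `A_ω`, constant `K̄` gives one of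
  `𝒢·K(σ,u)·𝒢′` with terms `𝒢T_ω𝒢′`, amplitudes `rr′A_ω`, constant `rr′K̄` — same walks, distances, rates, σ-structure (`𝒢`, `𝒢′`
  independent of `σ`, `u`).
USE (next file on the staged chain): the gauge covariance identity of the model covariant multi-level operator and the transfer of the
Green-function END from `U^g` (in the (3.37) window) to `U`.  Value: bookkeeping; words of row (D4) UNCHANGED.

References: T. Bałaban, Comm. Math. Phys. **99** (1985) 389–434 [B9], p. 398, (3.28)–(3.34) pp. 395–396, Cor. 3.6 p. 408, (3.108) p. 416;
Comm. Math. Phys. **116** (1988) [II], p. 13, p. 15.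
-/

noncomputable section

namespace Summit.QuantumFields.BalabanUV.Gaps.D4WalkBlockConjugate

open Metric Set Finset
open Literature.MathematicalPhysics.QuantumFieldTheory.Balaban1983to89
open Literature.MathematicalPhysics.QuantumFieldTheory.Balaban1983to89.B9SectDWalk (Through MajSumLe)
open Literature.MathematicalPhysics.QuantumFieldTheory.Balaban1983to89.B9Thm34Ext (toB6)
open Literature.MathematicalPhysics.QuantumFieldTheory.Balaban1983to89.B9Thm37GlueTorus (torusGeom tdist1)
open Literature.MathematicalPhysics.QuantumFieldTheory.Balaban1983to89.TreeLengthTorus (TPt)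
open Literature.MathematicalPhysics.QuantumFieldTheory.Balaban1983to89.B5TorusCover (UT)
open Summit.QuantumFields.BalabanUV.Gaps.D4WalkBlock (rowMass blockNorm rowMass_nonneg blockNorm_nonneg rowMass_le_blockNorm
  blockNorm_le_of_rowMass_le blockNorm_mul_le BlockWalkExpansion)

/-! ## §1. Cube-local, row-bounded operators in block currency -/

section Local

variable {ν : ℕ} {K : Fin ν → ℕ}
variable {p n q : Type} [Fintype p] [Fintype n] [Fintype q]
variable (cub : p → UT K) (cubn : n → UT K) (cubq : q → UT K)

/-- The row mass of a cube-local operator inside a foreign cube vanishes. -/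
theorem rowMass_local_offDiag (G : Matrix p p ℂ) (hG : ∀ i j, cub i ≠ cub j → G i j = 0) (i : p) {y' : UT K}
    (h : cub i ≠ y') : rowMass cub G i y' = 0 := by
  unfold rowMass
  refine Finset.sum_eq_zero fun j hj => ?_
  rw [hG i j (by rw [(Finset.mem_filter.1 hj).2]; exact h), norm_zero]

omit [Fintype p] in
/-- The row mass of a cube-local operator is at most its row sum. -/
theorem rowMass_le_rowSum (G : Matrix p n ℂ) (i : p) (y' : UT K) : rowMass cubn G i y' ≤ ∑ j, ‖G i j‖ :=
  Finset.sum_le_sum_of_subset_of_nonneg (Finset.filter_subset _ _) fun _ _ _ => norm_nonneg _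

/-- **Off-diagonal blocks of a cube-local operator vanish.** -/
theorem blockNorm_local_offDiag (G : Matrix p p ℂ) (hG : ∀ i j, cub i ≠ cub j → G i j = 0) {y y' : UT K} (h : y ≠ y') :
    blockNorm cub cub G y y' = 0 := by
  refine le_antisymm (blockNorm_le_of_rowMass_le cub cub G y y' le_rfl fun i hi => ?_) (blockNorm_nonneg cub cub G y y')
  rw [rowMass_local_offDiag cub G hG i (by rw [hi]; exact h)]

/-- Every block of an operator with row sums `≤ r` is `≤ r`. -/
theorem blockNorm_le_of_rowSum (G : Matrix p n ℂ) {r : ℝ} (hr0 : 0 ≤ r) (hr : ∀ i, ∑ j, ‖G i j‖ ≤ r) (y y' : UT K) :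
    blockNorm cub cubn G y y' ≤ r :=
  blockNorm_le_of_rowMass_le cub cubn G y y' hr0 fun i _ => (rowMass_le_rowSum cubn G i y').trans (hr i)

/-- **LEFT multiplication by a cube-local operator with row sums `≤ r`**: `‖𝒢M‖_{y,y′} ≤ r·‖M‖_{y,y′}` (the cube sum of
`blockNorm_mul_le` collapses to `y″ = y`). [cite: Balaban1985BackgroundPropagators, (3.108) p.416] -/
theorem blockNorm_local_mul_le (G : Matrix p p ℂ) (hG : ∀ i j, cub i ≠ cub j → G i j = 0) {r : ℝ} (hr0 : 0 ≤ r)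
    (hr : ∀ i, ∑ j, ‖G i j‖ ≤ r) (M : Matrix p n ℂ) (y y' : UT K) :
    blockNorm cub cubn (G * M) y y' ≤ r * blockNorm cub cubn M y y' := by
  classical
  refine (blockNorm_mul_le cub cub cubn G M y y').trans ?_
  rw [Finset.sum_eq_single y (fun y'' _ hy'' => by rw [blockNorm_local_offDiag cub G hG (Ne.symm hy''), zero_mul])
    (fun h => (h (Finset.mem_univ y)).elim)]
  exact mul_le_mul_of_nonneg_right (blockNorm_le_of_rowSum cub cub G hr0 hr y y) (blockNorm_nonneg cub cubn M y y')

/-- **RIGHT multiplication by a cube-local operator with row sums `≤ r′`**: `‖M𝒢′‖_{y,y′} ≤ ‖M‖_{y,y′}·r′`.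
[cite: Balaban1985BackgroundPropagators, (3.108) p.416] -/
theorem blockNorm_mul_local_le (M : Matrix p n ℂ) (G' : Matrix n n ℂ) (hG' : ∀ i j, cubn i ≠ cubn j → G' i j = 0) {r' : ℝ}
    (hr0 : 0 ≤ r') (hr' : ∀ i, ∑ j, ‖G' i j‖ ≤ r') (y y' : UT K) :
    blockNorm cub cubn (M * G') y y' ≤ blockNorm cub cubn M y y' * r' := by
  classical
  refine (blockNorm_mul_le cub cubn cubn M G' y y').trans ?_
  rw [Finset.sum_eq_single y' (fun y'' _ hy'' => by rw [blockNorm_local_offDiag cubn G' hG' hy'', mul_zero])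
    (fun h => (h (Finset.mem_univ y')).elim)]
  exact mul_le_mul_of_nonneg_left (blockNorm_le_of_rowSum cubn cubn G' hr0 hr' y' y') (blockNorm_nonneg cub cubn M y y')

end Local

/-! ## §2. Conjugation of a block walk expansion -/

section Conj

variable {d N' : ℕ} {ν : ℕ} {K : Fin ν → ℕ} [∀ i, NeZero (K i)]
variable {E : Type*} [NormedAddCommGroup E] [NormedSpace ℂ E]
variable {p n : Type} [Fintype p] [Fintype n]
variable {c : B13.Consts} {cub : p → UT K} {cubn : n → UT K} {K2 : (TPt d N' → ℂ) → E → Matrix p n ℂ}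
variable {X : Finset (UT K)} {R ε kap Kbar : ℝ}
variable {W : Type} {T2 : W → (TPt d N' → ℂ) → E → Matrix p n ℂ} {SX : Set W} {A : W → ℝ}
variable {D : W → UT K → UT K → ℝ} {ρ : ℝ}

/-- **CONJUGATION OF A BLOCK WALK EXPANSION** by cube-local, row-bounded, `(σ,u)`-independent operators `𝒢` (left, rows `≤ r`) and `𝒢′`
(right, rows `≤ r′`): `𝒢K(σ,u)𝒢′ = Σ_ω 𝒢T_ω(σ,u)𝒢′` is a block walk expansion with the same walks, distances, rates and σ-structure,
amplitudes `rr′A_ω` and constant `rr′K̄`.  The block-currency form of the gauge transfer `G(U^g) = 𝒢G(U)𝒢⁻¹` (and of a fibre-basis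
change). [cite: Balaban1985BackgroundPropagators, p.398, Cor. 3.6 p.408, (3.108) p.416; Balaban1988RG2Cluster, p.13, p.15] -/
theorem _root_.Summit.QuantumFields.BalabanUV.Gaps.D4WalkBlock.BlockWalkExpansion.conj (h : BlockWalkExpansion c cub cubn K2 X R ε kap Kbar T2 SX A D ρ) (G : Matrix p p ℂ)
    (G' : Matrix n n ℂ) (hG : ∀ i j, cub i ≠ cub j → G i j = 0) (hG' : ∀ i j, cubn i ≠ cubn j → G' i j = 0) {r r' : ℝ}
    (hr0 : 0 ≤ r) (hr0' : 0 ≤ r') (hr : ∀ i, ∑ j, ‖G i j‖ ≤ r) (hr' : ∀ i, ∑ j, ‖G' i j‖ ≤ r') :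
    BlockWalkExpansion c cub cubn (fun σ u => G * K2 σ u * G') X R ε kap (r * r' * Kbar) (fun ω σ u => G * T2 ω σ u * G') SX
      (fun ω => r * r' * A ω) D ρ where
  hasSum σ hσ u hu i j := by
    have e : ∀ M : Matrix p n ℂ, (G * M * G') i j = ∑ l, (∑ k, G i k * M k l) * G' l j := fun M => by
      simp only [Matrix.mul_apply]
    simp only [e]
    exact hasSum_sum fun l _ => (hasSum_sum fun k _ => (h.hasSum σ hσ u hu k l).mul_left (G i k)).mul_right (G' l j)
  termAnalytic ω σ hσ i j := by
    have e : ∀ M : Matrix p n ℂ, (G * M * G') i j = ∑ l, (∑ k, G i k * M k l) * G' l j := fun M => by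
      simp only [Matrix.mul_apply]
    simp only [e]
    exact DifferentiableOn.fun_sum fun l _ =>
      (DifferentiableOn.fun_sum fun k _ => (h.termAnalytic ω σ hσ k l).const_mul (G i k)).mul_const (G' l j)
  majB ω σ hσ u hu y y' := by
    rw [Matrix.mul_assoc]
    calc blockNorm cub cubn (G * (T2 ω σ u * G')) y y' ≤ r * blockNorm cub cubn (T2 ω σ u * G') y y' :=
          blockNorm_local_mul_le cub cubn G hG hr0 hr _ y y'
      _ ≤ r * (blockNorm cub cubn (T2 ω σ u) y y' * r') :=
          mul_le_mul_of_nonneg_left (blockNorm_mul_local_le cub cubn _ G' hG' hr0' hr' y y') hr0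
      _ ≤ r * (A ω * Real.exp (-(ρ * D ω y y')) * r') :=
          mul_le_mul_of_nonneg_left (mul_le_mul_of_nonneg_right (h.majB ω σ hσ u hu y y') hr0') hr0
      _ = r * r' * A ω * Real.exp (-(ρ * D ω y y')) := by ring
  majSum S a b := by
    have hs := h.majSum S a b
    have e : ∑ ω ∈ S, r * r' * A ω * Real.exp (-((ρ - ε) * D ω a b)) =
        (r * r') * ∑ ω ∈ S, A ω * Real.exp (-((ρ - ε) * D ω a b)) := by
      rw [Finset.mul_sum]; exact Finset.sum_congr rfl fun ω _ => by ring
    rw [e]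
    calc (r * r') * ∑ ω ∈ S, A ω * Real.exp (-((ρ - ε) * D ω a b)) ≤ (r * r') * (Kbar * Real.exp (-(kap * tdist1 K a b))) :=
          mul_le_mul_of_nonneg_left hs (mul_nonneg hr0 hr0')
      _ = r * r' * Kbar * Real.exp (-(kap * tdist1 K a b)) := by ring
  indep ω hω σ hσ := by
    show G * T2 ω σ 0 * G' = G * T2 ω 0 0 * G'
    rw [h.indep ω hω σ hσ]
  through := h.through
  A_nonneg ω := mul_nonneg (mul_nonneg hr0 hr0') (h.A_nonneg ω)
  D_nonneg := h.D_nonneg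

end Conj

end Summit.QuantumFields.BalabanUV.Gaps.D4WalkBlockConjugate

end
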